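import Summits.CriticalPhenomena.SAWScalingLimit.Theses.SAWLeftRightFKG
import Summits.CriticalPhenomena.SAWScalingLimit.Theorems.BoundaryTP2Negative_Box3
import Literature.Probability.LatticeModels.LatticeLoopEnclosure

/-!
# Sketch for crux `NotFKGAtOne` (stmt-CriticalPhenomena-11233), crux-ideate round 1, ideator 2

First-lemma signatures for the idea cards
* `three-by-three-corner-witness`  (§A): transport of `DomainSAW` along equal domain graphs + the
  3 × 3 counting certificate `|A| = |B| = 6`, `|A ∩ B| = 2`, `|univ| = 12`;
* `closed-walk-winding-dictionary` (§B): `wind` of lattice polylines / lens loops = Kasteleyn's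
  combinatorial winding number `ClosedWalk.W`, hence decidable `Ω_1` and decidable `≼` for every
  closed lattice walk `C`;
and the shared logical frame `notFKGAtOne_of_witness` (§0, proved).
Stubs are `sorry` by design (crux-ideate files no skeleton); everything elaborates.
-/

namespace Summit.CriticalPhenomena.SAWScalingLimit.Cruxes.NotFKGAtOne.SketchIdeator2

open MeasureTheory Literature.Probability.LatticeModels Literature.Probability.RandomPlanarGeometry
  Literature.Topology.PlaneTopology

noncomputable section

/-! ## §0 The logical frame: one certified instance refutes the `∀` -/

/-- The wind-defined domain of a closed lattice walk at mesh `δ` (verbatim the crux's `let Ω`). -/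
def windDomain (δ : ℝ) {c : Site 2} (C : (zdGraph 2).Walk c c) : Set ℂ :=
  {z | wind (fun t : ℝ => Set.IccExtend zero_le_one (C.toCurve (meshPoint δ)) t - z) ≠ 0}

/-- The crux's left–right preorder on chords (verbatim the crux's `let le`). -/
def lensLE (δ : ℝ) {Ω : Set ℂ} {a b : Site 2} (γ₁ γ₂ : SAW.DomainSAW Ω δ a b) : Prop :=
  ∀ z : ℂ, 0 ≤ wind (fun t : ℝ =>
    Set.IccExtend zero_le_one ((γ₁.walk.append γ₂.walk.reverse).toCurve (meshPoint δ)) t - z)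

/-- **Frame.** A single lattice instance with two `≼`-up-closed sets of chords whose counting-measure
covariance is negative proves the crux. (Pure logic; the cards differ in how the instance is certified.) -/
theorem notFKGAtOne_of_witness
    (h : ∃ (δ : ℝ) (c a b a' b' : Site 2) (C : (zdGraph 2).Walk c c),
      0 < δ ∧ a' ∈ C.support ∧ b' ∈ C.support ∧ (zdGraph 2).Adj a a' ∧ (zdGraph 2).Adj b b' ∧
      ∃ A B : Set (SAW.DomainSAW (windDomain δ C) δ a b),
        (∀ γ₁ γ₂, lensLE δ γ₁ γ₂ → γ₁ ∈ A → γ₂ ∈ A) ∧ (∀ γ₁ γ₂, lensLE δ γ₁ γ₂ → γ₁ ∈ B → γ₂ ∈ B) ∧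
        Measure.count (Set.univ : Set (SAW.DomainSAW (windDomain δ C) δ a b)) * Measure.count (A ∩ B)
          < Measure.count A * Measure.count B) :
    Theses.SAWLeftRightFKG.NotFKGAtOne := by
  obtain ⟨δ, c, a, b, a', b', C, hδ, ha', hb', haa, hbb, A, B, hA, hB, hlt⟩ := h
  intro H
  exact absurd (H δ c a b a' b' C hδ ha' hb' haa hbb A B hA hB) (not_le.mpr hlt)

/-! ## §A  Card `three-by-three-corner-witness` -/

/-- **First lemma (A1): transport.** `DomainSAW Ω δ a b` only sees the domain graph: two domains with
the same `discreteDomainGraph` have length-preserving equivalent chord types (via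
`SimpleGraph.Walk.transfer`), so the tree's certified enumeration of the 3 × 3 box
`Ω₃ = siteDomain (boxSites 0 2)` (`BoundaryTP2Negative_Box3`: `adj₃_iff`, `nb₃`, `Z₃_eq`) serves the
wind-domain of the lattice rectangle `∂[-1,3]²` once `adj_windRect_iff` (A2) is known. -/
theorem domainSAW_equiv_of_adj_iff {Ω Ω' : Set ℂ} {δ δ' : ℝ}
    (h : ∀ x y, (discreteDomainGraph Ω δ).Adj x y ↔ (discreteDomainGraph Ω' δ').Adj x y) (a b : Site 2) :
    ∃ e : SAW.DomainSAW Ω δ a b ≃ SAW.DomainSAW Ω' δ' a b,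
      ∀ γ, (e γ).walk.support = γ.walk.support := by
  sorry

/-- **First lemma (A2): the wind-domain of a lattice rectangle is the box** (the sister disprover's
`meshDomain_Ωb` / `dAdj_iff`, NegA.lean rc0, stated for a general rectangle; convexity route:
inside ⇒ `wind = 1` (`one_le_wind_polygonLoop_sub`-type), outside ⇒ `0` (half-plane logarithm),
on the trace ⇒ junk `0`). -/
theorem adj_windRect_iff {c : Site 2} (C : (zdGraph 2).Walk c c) (x₀ y₀ x₁ y₁ : ℤ)
    (hx : x₀ + 2 ≤ x₁) (hy : y₀ + 2 ≤ y₁)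
    (hC : ∀ u : Site 2, u ∈ C.support ↔ ((u 0 = x₀ ∨ u 0 = x₁) ∧ y₀ ≤ u 1 ∧ u 1 ≤ y₁) ∨
                                       ((u 1 = y₀ ∨ u 1 = y₁) ∧ x₀ ≤ u 0 ∧ u 0 ≤ x₁))
    (hwind : wind (fun t : ℝ => Set.IccExtend zero_le_one (C.toCurve (meshPoint 1)) t -
      meshPoint 1 ![x₀ + 1, y₀ + 1]) ≠ 0)
    (x y : Site 2) :
    (discreteDomainGraph (windDomain 1 C) 1).Adj x y ↔
      (zdGraph 2).Adj x y ∧ x ∈ boxSites ![x₀ + 1, y₀ + 1] ![x₁ - 1, y₁ - 1] ∧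
        y ∈ boxSites ![x₀ + 1, y₀ + 1] ![x₁ - 1, y₁ - 1] := by
  sorry

/-- **The certificate (A3), over the tree's box `Ω₃`:** among the 12 corner-to-corner chords of the
3 × 3 box, 6 start with the step up, 6 end with the step from the west, and 2 do both
(`UURR`, `URUR`); `6 · 6 = 36 > 24 = 12 · 2`.  (`decide` on `pathsFrom eqSite nb₃ 8`.) -/
theorem box3_corner_counts :
    Measure.count (Set.univ : Set (SAW.DomainSAW Theorems.BoundaryTP2.Negative.Ω₃ 1 ![0, 0] ![2, 2])) = 12 ∧
    Measure.count {γ : SAW.DomainSAW Theorems.BoundaryTP2.Negative.Ω₃ 1 ![0, 0] ![2, 2] |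
        γ.walk.getVert 1 = ![0, 1]} = 6 ∧
    Measure.count {γ : SAW.DomainSAW Theorems.BoundaryTP2.Negative.Ω₃ 1 ![0, 0] ![2, 2] |
        γ.walk.getVert (γ.length - 1) = ![1, 2]} = 6 ∧
    Measure.count ({γ : SAW.DomainSAW Theorems.BoundaryTP2.Negative.Ω₃ 1 ![0, 0] ![2, 2] |
        γ.walk.getVert 1 = ![0, 1]} ∩ {γ | γ.walk.getVert (γ.length - 1) = ![1, 2]}) = 2 := by
  sorry

/-- **Up-closure of the corner events (A4)** for the crux's `le` on the wind-rectangle (probe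
argument: the downward probe from the centre of the corner face `[0,1]²` is crossed only by the edge
`(0,0)–(1,0)`; the sister disprover's `wcross_le_of_wind_nonneg`). -/
theorem firstStepUp_upClosed {c : Site 2} (C : (zdGraph 2).Walk c c)
    (hadj : ∀ x y, (discreteDomainGraph (windDomain 1 C) 1).Adj x y ↔
      (zdGraph 2).Adj x y ∧ x ∈ boxSites ![0, 0] ![2, 2] ∧ y ∈ boxSites ![0, 0] ![2, 2])
    (γ₁ γ₂ : SAW.DomainSAW (windDomain 1 C) 1 ![0, 0] ![2, 2]) (h : lensLE 1 γ₁ γ₂)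
    (h₁ : γ₁.walk.getVert 1 = ![0, 1]) : γ₂.walk.getVert 1 = ![0, 1] := by
  sorry

/-! ## §B  Card `closed-walk-winding-dictionary` -/

/-- A closed lattice walk `w` of `zdGraph 2` presented as a `ClosedWalk n` (`n = w.length`): the
periodic vertex function reads the support. -/
def Presents {c : Site 2} (w : (zdGraph 2).Walk c c) {n : ℕ} (cw : ClosedWalk n) : Prop :=
  w.length = n ∧ ∀ j, cw.v j = ((w.getVert (j % n)) 0, (w.getVert (j % n)) 1)

/-- **First lemma (B1): the dictionary at face centres.** The winding number of the crux's
parametrised polyline of a closed lattice walk about the centre of the unit face `f` is Kasteleyn's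
combinatorial winding number `ClosedWalk.W` (tree: `ClosedWalk.wind_loop_sub_ctr` for the
`Path.trans`-polygon `ClosedWalk.loop`; here for `IccExtend ∘ toCurve (meshPoint 1)`, by
reparametrisation invariance `Curve.wind_reparam` / `wind_eq_of_homotopy`, or natively by
`Path.crossInc_trans` + `crossInc_edge`). -/
theorem wind_toCurve_sub_ctr {c : Site 2} (w : (zdGraph 2).Walk c c) {n : ℕ} (hn : 0 < n)
    (cw : ClosedWalk n) (hw : Presents w cw) (f : ℤ × ℤ) :
    wind (fun t : ℝ => Set.IccExtend zero_le_one (w.toCurve (meshPoint 1)) t - ctr f) = cw.W f := by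
  sorry

/-- **(B2) decidable `Ω_1`:** a lattice point is a mesh vertex of the wind-domain iff it is off the
walk and the face north-east of it has non-zero combinatorial winding number (off the walk the four
faces around a lattice point agree, `ClosedWalk.faceSum_eq_of_notMem` / `W_eq_of_notMem`, and the
point's winding equals theirs by local constancy). -/
theorem mem_meshVertices_windDomain_iff {c : Site 2} (C : (zdGraph 2).Walk c c) {n : ℕ} (hn : 0 < n)
    (cw : ClosedWalk n) (hC : Presents C cw) (u : Site 2) :
    u ∈ meshVertices (windDomain 1 C) 1 ↔ u ∉ C.support ∧ cw.W (u 0, u 1) ≠ 0 := by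
  sorry

/-- **(B3) decidable `≼`:** for chords of the wind-domain, the crux's `le` holds iff the lens walk's
combinatorial winding number is `≥ 0` on every face of a bounding box (`W` vanishes outside it,
`ClosedWalk.W_eq_zero_of_notMem_box`; points off the lattice faces' centres: `wind` is locally
constant off the trace and junk `0` on it). -/
theorem lensLE_iff_W_nonneg {c a b : Site 2} (C : (zdGraph 2).Walk c c)
    (γ₁ γ₂ : SAW.DomainSAW (windDomain 1 C) 1 a b) {n : ℕ} (hn : 0 < n) (cw : ClosedWalk n)
    (hlens : (γ₁.walk.append γ₂.walk.reverse).length = n ∧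
      ∀ j, cw.v j = (((γ₁.walk.append γ₂.walk.reverse).getVert (j % n)) 0,
                     ((γ₁.walk.append γ₂.walk.reverse).getVert (j % n)) 1)) :
    lensLE 1 γ₁ γ₂ ↔ ∀ f : ℤ × ℤ, 0 ≤ cw.W f := by
  sorry

end

end Summit.CriticalPhenomena.SAWScalingLimit.Cruxes.NotFKGAtOne.SketchIdeator2
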